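/-
b2b-lace packet, LEAN TYPING SEAT 2 gen 15 (unit `b2b-lace-lean2-g15`).  The App.-C-consistent Step-4 summand of the `f₃` bound map
(DIVERGENCE D75; REFEREE v68 R385 / ORDERS (1): "the corrected improvement map with `NobleLaplacianBounds.abs_H4_le` in the place of
`F3Bounds.boundH4` — NEW module(s); `F3Bounds` untouched").  Sibling of `F3Bounds.lean` (UNCHANGED); consumed by the docstrings of
`MeanFieldD11CertRev8.lean` (what its `bo8` cells discharge) and by the (S2b)-IMPR chain.
-/
import Literature.Probability.FitznerVanDerHofstad2017.F3Bounds
import Literature.Probability.FitznerVanDerHofstad2017.NobleLaplacianBounds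
import HarnessLib

/-!
# Literature.Probability.FitznerVanDerHofstad2017.F3BoundsD75 — the App.-C-consistent Step-4 summand of (3.87), typed beside `F3Bounds`

[NoBLE17] = Fitzner–van der Hofstad, *Generalized approach to the non-backtracking lace expansion*, PTRF 169 (2017) 1041–1119;
[FvdH17] = *Mean-field behavior for nearest-neighbor percolation in d > 10*, EJP 22 (2017) no. 43 (supplementary notebook `General.nb`).

`F3Bounds.boundH4` reproduces [NoBLE17] (3.78) / `General.nb` In[2] `BoundH[4,…]` AS PRINTED AND CODED:
`K̲ (β_{ΔR,Φ} K_{n,l}(x) + β_{|ΔR,F|} Γ₂′ K_{n+1,l}(x))`.  The tree's pointwise Fourier-space Step-4 bound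
`NobleLaplacianBounds.LapAtoms.KeyBounds.abs_H4_le` is `|Ĥ₄(k)| ≤ K̲ Ĉ(k) (β_{ΔR,Φ} + β_{|ΔR,F|} Γ₂′ Ĉ(k))`, `Ĉ(k) = 1/[1 − D̂(k)]`: one power
of `Ĉ` more than the print (the print would need `1/[1 − F̂(k)] ≤ K̲` uniformly in `k`, which (3.46) does not give near `k = 0`; the extra
power is what [NoBLE17] App. C supports — DIVERGENCE D75 of the b2b-lace audit, referee ruling REFEREE v68 R385).  Multiplying by the `n`
two-point lines of the diagram `ℋ^{n,l}` (`|Ĝ(k)| ≤ Γ₂′ Ĉ(k)`, (3.47) = `KeyBounds.abs_G_le`) gives the pointwise majorant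
`K̲ Γ₂′ⁿ (β_{ΔR,Φ} Ĉ^{n+1} + β_{|ΔR,F|} Γ₂′ Ĉ^{n+2})` (`LapAtoms.KeyBounds.pow_abs_G_mul_abs_H4_le` below), whose integral against the
`(l, x)`-kernel, with the dictionary `∫ Ĉ^m · (kernel) ↦ K_{m,l}(x)` of [NoBLE17] §3.3.4 (3.35)–(3.38), is the APP.-C-CONSISTENT STEP-4 SUMMAND

  `boundH4D75 τ n l v a = K̲ · Γ₂′ⁿ · (β_{ΔR,Φ} · K_{n+1,l}(v) + β_{|ΔR,F|} · Γ₂′ · K_{n+2,l}(v))`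

— exactly the engines' token `d75` (engine A: the count-asserted text patch of `General.nb` In[2]
`Kunderline*((bRpDelta*K[n,l,v])+((bRfDelta*Gamma2dash)*K[n+1,l,v]))` → `(Kunderline*Gamma2dash^n)*((bRpDelta*K[n+1,l,v])+((bRfDelta*Gamma2dash)*K[n+2,l,v]))`,
num5-g14 `d75_patch.py` / num1-g22 `h4_patch.py`; engine B: interpreter token `d75`, num2-g20), with which the cells `D11.bo8` of Cert rev 8 were computed.
This module declares that summand and the resulting bound map `boundHD75 = H1 + H2 + H3 + H4D75 + H5`, `boundFThreeD75` (cell maximum), their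
M3-monotone minorants, and proves the order properties `F3Bounds` proves for the printed map (monotone in the information order on well-formed
arguments; minorant inequalities).  `F3Bounds` is NOT modified: the printed map and this one coexist, as Cert rev 7 (print-faithful, of record)
and Cert rev 8 (D75, record candidate) do.

Nothing here is a cited fact: every declaration is a definition (the D75 text of the summand) or a theorem proved from it and from
`NobleLaplacianBounds`; no numeral and no dimension enters.
[cite: FitznerVanDerHofstad2016NoBLE, §3.3.5 Step 4 (3.78) p. 1077 and (3.87) p. 1079, §3.3.4 (3.46)–(3.47) p. 1072, App. C;
 FitznerVanDerHofstad2017, supplementary notebook General.nb In[2]–In[3]]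
-/

noncomputable section

namespace Literature.Probability.FitznerVanDerHofstad2017

/-! ## The pointwise majorant behind the summand -/

namespace LapAtoms.KeyBounds

variable {a : LapAtoms} {r : F3Bounds.Args} (h : a.KeyBounds r)
include h

/-- **Step 4 with the `n` two-point lines, pointwise in `k`** (App.-C-consistent form, DIVERGENCE D75): from `abs_H4_le`
(`|Ĥ₄| ≤ K̲ Ĉ (β_{ΔR,Φ} + β_{|ΔR,F|} Γ₂′ Ĉ)`) and (3.47) (`|Ĝ| ≤ Γ₂′ Ĉ`),
`|Ĝ(k)|ⁿ |Ĥ₄(k)| ≤ K̲ Γ₂′ⁿ (β_{ΔR,Φ} Ĉ(k)^{n+1} + β_{|ΔR,F|} Γ₂′ Ĉ(k)^{n+2})`, `Ĉ = 1/[1 − D̂]` — the integrand whose `(l,x)`-kernel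
integral is `F3Bounds.boundH4D75` under `∫ Ĉ^m ↦ K_{m,l}`.
[cite: FitznerVanDerHofstad2016NoBLE, §3.3.5 Step 4 p. 1077 with §3.3.4 (3.46)–(3.47) p. 1072 and App. C] -/
theorem pow_abs_G_mul_abs_H4_le (n : ℕ) :
    |a.G| ^ n * |a.H4| ≤
      r.Kunderline * r.Gamma2dash ^ n *
        (r.bRpDelta * (1 / (1 - a.D)) ^ (n + 1) + r.bRfDelta * r.Gamma2dash * (1 / (1 - a.D)) ^ (n + 2)) := by
  have hC : 0 < 1 / (1 - a.D) := h.C_pos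
  have hK : 0 ≤ r.Kunderline := h.K_nn
  have hΓ : 0 ≤ r.Gamma2dash := h.Gamma2dash_nn
  have hbF : 0 ≤ r.bRfDelta := h.bRfDelta_nn
  have hbΦ : 0 ≤ r.bRpDelta := h.bRpDelta_nn
  have hG : |a.G| ^ n ≤ (r.Gamma2dash * (1 / (1 - a.D))) ^ n :=
    pow_le_pow_left₀ (abs_nonneg _) h.abs_G_le n
  calc |a.G| ^ n * |a.H4|
      ≤ (r.Gamma2dash * (1 / (1 - a.D))) ^ n *
          (r.Kunderline * (r.bRpDelta * (1 / (1 - a.D)) + r.bRfDelta * r.Gamma2dash * (1 / (1 - a.D)) ^ 2)) :=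
        mul_le_mul hG h.abs_H4_le (abs_nonneg _) (by positivity)
    _ = _ := by ring

end LapAtoms.KeyBounds

namespace F3Bounds

variable {ν : Type*}

/-! ## The summand and the bound map -/

/-- The APP.-C-CONSISTENT Step-4 summand (DIVERGENCE D75; engines' token `d75`):
`K̲ · Γ₂′ⁿ · (β_{ΔR,Φ} K_{n+1,l}(v) + β_{|ΔR,F|} Γ₂′ K_{n+2,l}(v))` — the `(l,v)`-kernel integral of the pointwise majorant
`LapAtoms.KeyBounds.pow_abs_G_mul_abs_H4_le` under `∫ Ĉ^m ↦ τ.K m l v`; compare `boundH4` = (3.78) as printed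
(`K̲ (β_{ΔR,Φ} K_{n,l} + β_{|ΔR,F|} Γ₂′ K_{n+1,l})`: no `Γ₂′ⁿ`, one power of `Ĉ` less).
[cite: FitznerVanDerHofstad2016NoBLE, §3.3.5 Step 4 (3.78) p. 1077, App.-C-consistent form; FitznerVanDerHofstad2017, notebook General.nb In[2] `BoundH[4]` with the D75 patch] -/
def boundH4D75 (τ : Tables ν) (n l : ℕ) (v : ν) (a : Args) : ℝ :=
  a.Kunderline * a.Gamma2dash ^ n * (a.bRpDelta * τ.K (n+1) l v + a.bRfDelta * a.Gamma2dash * τ.K (n+2) l v)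

/-- The numerator of (3.87) with the App.-C-consistent Step 4: `H1 + H2 + H3 + H4D75 + H5` (the other four summands are `F3Bounds`', by name).
[cite: FitznerVanDerHofstad2016NoBLE, §3.3.5 (3.87) p. 1079 with Step 4 in the App.-C-consistent form] -/
def boundHD75 (τ : Tables ν) (n l : ℕ) (v : ν) (a : Args) : ℝ :=
  boundH1 τ n l v a + boundH2 τ n l v a + boundH3 τ n l v a + boundH4D75 τ n l v a + boundH5 τ n l v a

/-- Its M3-monotone minorant (`boundH3Mono` for `boundH3`, as `boundHMono`). [folklore] -/
def boundHMonoD75 (τ : Tables ν) (n l : ℕ) (v : ν) (a : Args) : ℝ :=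
  boundH1 τ n l v a + boundH2 τ n l v a + boundH3Mono τ n l v a + boundH4D75 τ n l v a + boundH5 τ n l v a

/-- `BoundFThree` with the App.-C-consistent Step 4: the cell maximum over the nodes `v ∈ v₀ :: vs` of `boundHD75`.
[cite: FitznerVanDerHofstad2016NoBLE, §3.3.5 (3.87) p. 1079; FitznerVanDerHofstad2017, notebook General.nb In[3] with the D75 patch of In[2]] -/
def boundFThreeD75 (τ : Tables ν) (n l : ℕ) (v₀ : ν) (vs : List ν) (a : Args) : ℝ :=
  vs.foldr (fun v acc => max (boundHD75 τ n l v a) acc) (boundHD75 τ n l v₀ a)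

/-- The M3-monotone minorant of `boundFThreeD75` (cellwise `boundHMonoD75`). [folklore] -/
def boundFThreeMonoD75 (τ : Tables ν) (n l : ℕ) (v₀ : ν) (vs : List ν) (a : Args) : ℝ :=
  vs.foldr (fun v acc => max (boundHMonoD75 τ n l v a) acc) (boundHMonoD75 τ n l v₀ a)

/-! ## Elementary relations -/

/-- The D75 map differs from the printed one exactly in the Step-4 summand. [folklore] -/
theorem boundHD75_eq_boundH_sub_add (τ : Tables ν) (n l : ℕ) (v : ν) (a : Args) :
    boundHD75 τ n l v a = boundH τ n l v a - boundH4 τ n l v a + boundH4D75 τ n l v a := by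
  simp only [boundHD75, boundH]; ring

/-- Same for the M3 minorants. [folklore] -/
theorem boundHMonoD75_eq_boundHMono_sub_add (τ : Tables ν) (n l : ℕ) (v : ν) (a : Args) :
    boundHMonoD75 τ n l v a = boundHMono τ n l v a - boundH4 τ n l v a + boundH4D75 τ n l v a := by
  simp only [boundHMonoD75, boundHMono]; ring

/-- At `n = 0` the summand is `K̲ (β_{ΔR,Φ} K_{1,l} + β_{|ΔR,F|} Γ₂′ K_{2,l})` — the shape of `abs_H4_le` under `∫ Ĉ^m ↦ K_{m,l}`. [folklore] -/
theorem boundH4D75_zero (τ : Tables ν) (l : ℕ) (v : ν) (a : Args) :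
    boundH4D75 τ 0 l v a = a.Kunderline * (a.bRpDelta * τ.K 1 l v + a.bRfDelta * a.Gamma2dash * τ.K 2 l v) := by
  simp [boundH4D75]

/-- The summand is non-negative on well-formed arguments and non-negative tables. [folklore] -/
theorem boundH4D75_nonneg {τ : Tables ν} (hτ : τ.Nonneg) {a : Args} (ha : a.WF) (n l : ℕ) (v : ν) :
    0 ≤ boundH4D75 τ n l v a := by
  obtain ⟨hG, hcp, haf, hafx, hap, hRp, hRfD, hRpD, hK⟩ := ha
  have := hτ.K (n+1) l v; have := hτ.K (n+2) l v
  simp only [boundH4D75]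
  positivity

/-- Every node's `boundHD75` is below the cell maximum `boundFThreeD75` (head node). [folklore] -/
theorem boundHD75_le_boundFThreeD75_head (τ : Tables ν) (n l : ℕ) (v₀ : ν) (vs : List ν) (a : Args) :
    boundHD75 τ n l v₀ a ≤ boundFThreeD75 τ n l v₀ vs a := by
  unfold boundFThreeD75
  induction vs with
  | nil => simp
  | cons v vs ih => simp only [List.foldr_cons]; exact ih.trans (le_max_right _ _)

/-- Every node's `boundHD75` is below the cell maximum `boundFThreeD75` (tail nodes). [folklore] -/
theorem boundHD75_le_boundFThreeD75_of_mem (τ : Tables ν) (n l : ℕ) (v₀ : ν) {vs : List ν} {v : ν} (hv : v ∈ vs) (a : Args) :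
    boundHD75 τ n l v a ≤ boundFThreeD75 τ n l v₀ vs a := by
  unfold boundFThreeD75
  induction vs with
  | nil => simp at hv
  | cons w vs ih =>
    simp only [List.foldr_cons]
    rcases List.mem_cons.1 hv with rfl | hv
    · exact le_max_left _ _
    · exact (ih hv).trans (le_max_right _ _)


/-! ## Order properties (as `F3Bounds` for the printed map) -/

section Mono

variable {τ : Tables ν} (hτ : τ.Nonneg) {a b : Args}
include hτ

/-- The D75 Step-4 summand is monotone in the information order on well-formed arguments. [folklore] -/
theorem boundH4D75_mono (ha : a.WF) (hb : b.WF) (h : Args.Dom a b) (n l : ℕ) (v : ν) :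
    boundH4D75 τ n l v a ≤ boundH4D75 τ n l v b := by
  obtain ⟨hG, hcp, haf, hafx, hap, hRp, hRfD, hRpD, hK⟩ := ha
  obtain ⟨hG', hcp', haf', hafx', hap', hRp', hRfD', hRpD', hK'⟩ := hb
  obtain ⟨dG, dcp, daf, dafx, dap, dRf, dRp, dRfD, dRpD, dK⟩ := h
  have := hτ.K (n+1) l v; have := hτ.K (n+2) l v
  simp only [boundH4D75]
  gcongr

/-- The M3-patched D75 numerator is monotone in the information order on well-formed arguments. [folklore] -/
theorem boundHMonoD75_mono (ha : a.WF) (hb : b.WF) (h : Args.Dom a b) (n l : ℕ) (v : ν) :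
    boundHMonoD75 τ n l v a ≤ boundHMonoD75 τ n l v b := by
  unfold boundHMonoD75
  gcongr
  · exact boundH1_mono hτ ha hb h n l v
  · exact boundH2_mono hτ ha hb h n l v
  · exact boundH3Mono_mono hτ ha hb h n l v
  · exact boundH4D75_mono hτ ha hb h n l v
  · exact boundH5_mono hτ ha hb h n l v

/-- The M3 patch is a minorant of the D75 numerator. [folklore] -/
theorem boundHMonoD75_le_boundHD75 (ha : a.WF) (n l : ℕ) (v : ν) :
    boundHMonoD75 τ n l v a ≤ boundHD75 τ n l v a := by
  unfold boundHMonoD75 boundHD75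
  have := boundH3Mono_le_boundH3 hτ ha n l v
  linarith

/-- `boundFThreeMonoD75` is monotone in the information order on well-formed arguments. [folklore] -/
theorem boundFThreeMonoD75_mono (ha : a.WF) (hb : b.WF) (h : Args.Dom a b) (n l : ℕ) (v₀ : ν) (vs : List ν) :
    boundFThreeMonoD75 τ n l v₀ vs a ≤ boundFThreeMonoD75 τ n l v₀ vs b := by
  unfold boundFThreeMonoD75
  induction vs with
  | nil => simpa using boundHMonoD75_mono hτ ha hb h n l v₀
  | cons v vs ih =>
    simp only [List.foldr_cons]
    exact max_le_max (boundHMonoD75_mono hτ ha hb h n l v) ih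

/-- `boundFThreeMonoD75 ≤ boundFThreeD75` on well-formed arguments. [folklore] -/
theorem boundFThreeMonoD75_le (ha : a.WF) (n l : ℕ) (v₀ : ν) (vs : List ν) :
    boundFThreeMonoD75 τ n l v₀ vs a ≤ boundFThreeD75 τ n l v₀ vs a := by
  unfold boundFThreeMonoD75 boundFThreeD75
  induction vs with
  | nil => simpa using boundHMonoD75_le_boundHD75 hτ ha n l v₀
  | cons v vs ih =>
    simp only [List.foldr_cons]
    exact max_le_max (boundHMonoD75_le_boundHD75 hτ ha n l v) ih

end Mono

end F3Bounds

end Literature.Probability.FitznerVanDerHofstad2017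

end
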